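import Mathlib

/-!
# Partial sums of positive widths tile `[0, total)`

Helper of the algebraic-area layer of crux stmt-KontsevichZagierPeriods-9847
(`PlanarK0Injective`, route SymplecticScissors, line lead seat c5).

For a finite set `T` in a linear order and positive widths `w j` (`j ∈ T`), put
`c j := ∑ i ∈ T with i < j, w i` and `ℓ := ∑ i ∈ T, w i`.  The windows `[c j, c j + w j)`
lie in `[0, ℓ]`, are disjoint and increasing in the order of `T`, and cover `[0, ℓ)`.
This is the bookkeeping used by the flattening move, which sends the `j`-th band of a
vertical fibre to the height window `(c j, c j + w j) / ℓ` of the unit strip.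
-/

open Finset
open scoped BigOperators

namespace Summit.KontsevichZagierPeriods.SymplecticScissors.PlanarK0InjectiveAlgebraicLayer

/-- `c j + w j` is the sum of `w` over `insert j {i ∈ T | i < j}`. -/
private theorem sum_filter_lt_add_eq_sum_insert {ι : Type*} [LinearOrder ι] (T : Finset ι)
    (w : ι → ℝ) (j : ι) :
    (∑ i ∈ T.filter (· < j), w i) + w j = ∑ i ∈ insert j (T.filter (· < j)), w i := by
  rw [Finset.sum_insert (by simp), add_comm]

/-- The covering part, by induction on the maximum of `T`. -/
private theorem exists_window_of_lt_sum {ι : Type*} [LinearOrder ι] (w : ι → ℝ) (T : Finset ι) :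
    (∀ i ∈ T, 0 < w i) → ∀ t : ℝ, 0 ≤ t → t < ∑ i ∈ T, w i →
      ∃ j ∈ T, (∑ i ∈ T.filter (· < j), w i) ≤ t ∧
        t < (∑ i ∈ T.filter (· < j), w i) + w j := by
  classical
  induction T using Finset.induction_on_max with
  | empty =>
    intro _ t ht0 ht
    rw [Finset.sum_empty] at ht
    exact absurd ht (not_lt.mpr ht0)
  | insert a s ha ih =>
    intro hw t ht0 ht
    have has : a ∉ s := fun h => lt_irrefl a (ha a h)
    rw [Finset.sum_insert has] at ht
    have hfilt : (insert a s).filter (· < a) = s := by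
      ext i
      simp only [Finset.mem_filter, Finset.mem_insert]
      constructor
      · rintro ⟨rfl | hi, hlt⟩
        · exact absurd hlt (lt_irrefl _)
        · exact hi
      · intro hi
        exact ⟨Or.inr hi, ha i hi⟩
    by_cases hts : t < ∑ i ∈ s, w i
    · obtain ⟨j, hj, h1, h2⟩ := ih (fun i hi => hw i (Finset.mem_insert_of_mem hi)) t ht0 hts
      have hfj : (insert a s).filter (· < j) = s.filter (· < j) := by
        rw [Finset.filter_insert, if_neg (not_lt.mpr (ha j hj).le)]
      exact ⟨j, Finset.mem_insert_of_mem hj, by rw [hfj]; exact h1, by rw [hfj]; exact h2⟩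
    · refine ⟨a, Finset.mem_insert_self a s, ?_, ?_⟩
      · rw [hfilt]; exact not_lt.mp hts
      · rw [hfilt, add_comm]; exact ht

/-- **Partial sums of positive widths tile `[0, total)`.**  For a finite set `T` in a linear
order and widths `w j > 0` (`j ∈ T`), the partial sums `c j := ∑ i ∈ T with i < j, w i`
satisfy: `0 ≤ c j`; `c j + w j ≤ ∑ T w`; `c j + w j ≤ c j'` whenever `j < j'` in `T`; and
every `t ∈ [0, ∑ T w)` lies in some window `[c j, c j + w j)` with `j ∈ T`. [folklore] -/
theorem partialSums_intervals :
    ∀ {ι : Type*} [LinearOrder ι] (T : Finset ι) (w : ι → ℝ), (∀ i ∈ T, 0 < w i) →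
    (∀ j ∈ T, 0 ≤ ∑ i ∈ T.filter (· < j), w i) ∧
    (∀ j ∈ T, (∑ i ∈ T.filter (· < j), w i) + w j ≤ ∑ i ∈ T, w i) ∧
    (∀ j ∈ T, ∀ j' ∈ T, j < j' →
      (∑ i ∈ T.filter (· < j), w i) + w j ≤ ∑ i ∈ T.filter (· < j'), w i) ∧
    (∀ t : ℝ, 0 ≤ t → t < ∑ i ∈ T, w i →
      ∃ j ∈ T, (∑ i ∈ T.filter (· < j), w i) ≤ t ∧ t < (∑ i ∈ T.filter (· < j), w i) + w j) := by
  intro ι _ T w hw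
  have hw' : ∀ i ∈ T, 0 ≤ w i := fun i hi => (hw i hi).le
  refine ⟨?_, ?_, ?_, exists_window_of_lt_sum w T hw⟩
  · intro j _
    exact Finset.sum_nonneg fun i hi => hw' i (Finset.mem_of_mem_filter i hi)
  · intro j hj
    rw [sum_filter_lt_add_eq_sum_insert]
    exact Finset.sum_le_sum_of_subset_of_nonneg
      (Finset.insert_subset hj (Finset.filter_subset _ _)) (fun i hi _ => hw' i hi)
  · intro j hj j' _ hjj'
    rw [sum_filter_lt_add_eq_sum_insert]
    refine Finset.sum_le_sum_of_subset_of_nonneg ?_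
      (fun i hi _ => hw' i (Finset.mem_of_mem_filter i hi))
    refine Finset.insert_subset (Finset.mem_filter.mpr ⟨hj, hjj'⟩) ?_
    intro i hi
    rw [Finset.mem_filter] at hi ⊢
    exact ⟨hi.1, hi.2.trans hjj'⟩

end Summit.KontsevichZagierPeriods.SymplecticScissors.PlanarK0InjectiveAlgebraicLayer
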